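import Literature.NumberTheory.Sieve.SmoothMajorantZeta
import HarnessLib

/-!
# Local input for the smooth linear forms estimate (Conlon–Fox–Zhao §9): the zeta ratio near `1`

Trunk T-SIEVE. D. Conlon, J. Fox, Y. Zhao, *The Green–Tao theorem: an exposition*
(arXiv:1403.2957), §9, p. 18, the step (35) and its justification ("Error estimates: Estimate in (35)"): since `ζ(1+z) = (1 + O(|z|))/z` for
small `z ≠ 0`,
`ζ(1+z+z')/(ζ(1+z) ζ(1+z')) = (1 + O(δ)) · z z'/(z + z')` whenever `0 < |z|, |z'| ≤ δ`, `z + z' ≠ 0`,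
`δ` small. Proved here with explicit constants from `exists_bound_riemannZeta_sub_one_div`
(`SmoothMajorantZeta`).

## References
* D. Conlon, J. Fox, Y. Zhao, EMS Surv. Math. Sci. 1 (2014), 249–282, §9 (p. 18, (35) and "Estimate in (35)").
  [cite: ConlonFoxZhao2014]
-/

noncomputable section

namespace Literature.NumberTheory.Sieve.CFZ

/-- `ζ(1+u) = (1 + ε(u))/u` with `|ε(u)| ≤ C|u|` for `0 < |u| ≤ 1`.
[cite: ConlonFoxZhao2014, Section 9] -/
theorem exists_bound_zeta_one_add :
    ∃ C : ℝ, 0 ≤ C ∧ ∀ u : ℂ, u ≠ 0 → ‖u‖ ≤ 1 →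
      ‖u * riemannZeta (1 + u) - 1‖ ≤ C * ‖u‖ := by
  obtain ⟨C, hC⟩ := exists_bound_riemannZeta_sub_one_div
  refine ⟨max C 0, le_max_right _ _, fun u hu hu1 => ?_⟩
  have h := hC (1 + u) (by simpa using hu) (by simpa using hu1)
  have hid : u * riemannZeta (1 + u) - 1 = u * (riemannZeta (1 + u) - 1 / (1 + u - 1)) := by
    rw [add_sub_cancel_left]; field_simp
  rw [hid, norm_mul, mul_comm]
  exact mul_le_mul_of_nonneg_right (h.trans (le_max_left _ _)) (norm_nonneg _)

/-- Three small perturbations: `|(1+e₃)/((1+e₁)(1+e₂)) - 1| ≤ 4(|e₁| + |e₂| + |e₃| + |e₁||e₂|)` when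
`|e₁|, |e₂| ≤ 1/2`. [folklore] -/
theorem norm_perturb_ratio_sub_one_le (e₁ e₂ e₃ : ℂ) (h₁ : ‖e₁‖ ≤ 1 / 2) (h₂ : ‖e₂‖ ≤ 1 / 2) :
    ‖(1 + e₃) / ((1 + e₁) * (1 + e₂)) - 1‖ ≤ 4 * (‖e₁‖ + ‖e₂‖ + ‖e₃‖ + ‖e₁‖ * ‖e₂‖) := by
  have hn1 : (1 : ℝ) / 2 ≤ ‖1 + e₁‖ := by
    have := norm_sub_norm_le (1 : ℂ) (-e₁); rw [norm_one, norm_neg, sub_neg_eq_add] at this; linarith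
  have hn2 : (1 : ℝ) / 2 ≤ ‖1 + e₂‖ := by
    have := norm_sub_norm_le (1 : ℂ) (-e₂); rw [norm_one, norm_neg, sub_neg_eq_add] at this; linarith
  have hne1 : 1 + e₁ ≠ 0 := fun h => by rw [h, norm_zero] at hn1; linarith
  have hne2 : 1 + e₂ ≠ 0 := fun h => by rw [h, norm_zero] at hn2; linarith
  have hid : (1 + e₃) / ((1 + e₁) * (1 + e₂)) - 1 = (e₃ - e₁ - e₂ - e₁ * e₂) / ((1 + e₁) * (1 + e₂)) := by
    field_simp; ring
  rw [hid, norm_div, norm_mul, div_le_iff₀ (by positivity)]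
  calc ‖e₃ - e₁ - e₂ - e₁ * e₂‖ ≤ ‖e₃‖ + ‖e₁‖ + ‖e₂‖ + ‖e₁‖ * ‖e₂‖ := by
        calc ‖e₃ - e₁ - e₂ - e₁ * e₂‖ ≤ ‖e₃ - e₁ - e₂‖ + ‖e₁ * e₂‖ := norm_sub_le _ _
          _ ≤ ‖e₃ - e₁‖ + ‖e₂‖ + ‖e₁‖ * ‖e₂‖ := by rw [norm_mul]; gcongr; exact norm_sub_le _ _
          _ ≤ ‖e₃‖ + ‖e₁‖ + ‖e₂‖ + ‖e₁‖ * ‖e₂‖ := by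
              have := norm_sub_le e₃ e₁; linarith
    _ = 4 * (‖e₁‖ + ‖e₂‖ + ‖e₃‖ + ‖e₁‖ * ‖e₂‖) * (1 / 2 * (1 / 2)) := by ring
    _ ≤ 4 * (‖e₁‖ + ‖e₂‖ + ‖e₃‖ + ‖e₁‖ * ‖e₂‖) * (‖1 + e₁‖ * ‖1 + e₂‖) := by
        gcongr

/-- **The zeta ratio near `1`** (CFZ (35), "Estimate in (35)"): there are `δ₀ > 0` and `K` such that for
`0 < |z|, |z'| ≤ δ ≤ δ₀` with `z + z' ≠ 0`,
`|ζ(1+z+z')/(ζ(1+z)ζ(1+z')) - z z'/(z+z')| ≤ K δ |z z'/(z+z')|`.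
[cite: ConlonFoxZhao2014, Section 9] -/
theorem norm_zetaRatio_sub_le :
    ∃ δ₀ K : ℝ, 0 < δ₀ ∧ 0 ≤ K ∧ ∀ z z' : ℂ, z ≠ 0 → z' ≠ 0 → z + z' ≠ 0 → ∀ δ : ℝ, δ ≤ δ₀ →
      ‖z‖ ≤ δ → ‖z'‖ ≤ δ →
      ‖riemannZeta (1 + z + z') / (riemannZeta (1 + z) * riemannZeta (1 + z')) - z * z' / (z + z')‖ ≤
        K * δ * ‖z * z' / (z + z')‖ := by
  obtain ⟨C, hC0, hC⟩ := exists_bound_zeta_one_add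
  -- `δ₀` so small that `2δ₀ ≤ 1` and `C · 2δ₀ ≤ 1/2`
  refine ⟨1 / (4 * C + 2), 40 * C, by positivity, by positivity, fun z z' hz hz' hzz' δ hδ hzδ hz'δ => ?_⟩
  have hδ0 : 0 ≤ δ := (norm_nonneg _).trans hzδ
  have hδ1 : 2 * δ ≤ 1 := by
    have : δ ≤ 1 / 2 := hδ.trans (by rw [div_le_div_iff₀ (by positivity) (by norm_num)]; nlinarith)
    linarith
  have hCδ : C * (2 * δ) ≤ 1 / 2 := by
    have h1 : C * (2 * δ) ≤ C * (2 * (1 / (4 * C + 2))) := by gcongr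
    refine h1.trans ?_
    rw [show C * (2 * (1 / (4 * C + 2))) = 2 * C / (4 * C + 2) by ring, div_le_iff₀ (by positivity)]
    nlinarith
  -- the three perturbations
  set e₁ := z * riemannZeta (1 + z) - 1
  set e₂ := z' * riemannZeta (1 + z') - 1
  set e₃ := (z + z') * riemannZeta (1 + z + z') - 1
  have he₁ : ‖e₁‖ ≤ C * δ := (hC z hz (hzδ.trans (by linarith))).trans (by gcongr)
  have he₂ : ‖e₂‖ ≤ C * δ := (hC z' hz' (hz'δ.trans (by linarith))).trans (by gcongr)
  have he₃ : ‖e₃‖ ≤ C * (2 * δ) := by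
    have hn : ‖z + z'‖ ≤ 2 * δ := (norm_add_le _ _).trans (by linarith)
    have := hC (z + z') hzz' (hn.trans hδ1)
    have h13 : (1 : ℂ) + z + z' = 1 + (z + z') := add_assoc _ _ _
    simp only [e₃, h13]
    exact this.trans (by gcongr)
  have h1 : ‖e₁‖ ≤ 1 / 2 := he₁.trans (by nlinarith)
  have h2 : ‖e₂‖ ≤ 1 / 2 := he₂.trans (by nlinarith)
  -- the ratio in terms of the perturbations
  have hζ1 : riemannZeta (1 + z) = (1 + e₁) / z := by simp only [e₁]; field_simp; ring
  have hζ2 : riemannZeta (1 + z') = (1 + e₂) / z' := by simp only [e₂]; field_simp; ring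
  have hζ3 : riemannZeta (1 + z + z') = (1 + e₃) / (z + z') := by simp only [e₃]; field_simp; ring
  have hne1 : 1 + e₁ ≠ 0 := fun h => by
    have := norm_sub_norm_le (1 : ℂ) (-e₁)
    rw [norm_one, norm_neg, sub_neg_eq_add, h, norm_zero] at this; linarith
  have hne2 : 1 + e₂ ≠ 0 := fun h => by
    have := norm_sub_norm_le (1 : ℂ) (-e₂)
    rw [norm_one, norm_neg, sub_neg_eq_add, h, norm_zero] at this; linarith
  have hid : riemannZeta (1 + z + z') / (riemannZeta (1 + z) * riemannZeta (1 + z')) - z * z' / (z + z') =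
      z * z' / (z + z') * ((1 + e₃) / ((1 + e₁) * (1 + e₂)) - 1) := by
    rw [hζ1, hζ2, hζ3]; field_simp
  rw [hid, norm_mul, mul_comm]
  refine mul_le_mul_of_nonneg_right ?_ (norm_nonneg _)
  refine (norm_perturb_ratio_sub_one_le e₁ e₂ e₃ h1 h2).trans ?_
  have hprod : ‖e₁‖ * ‖e₂‖ ≤ C * δ * (1 / 2) := mul_le_mul he₁ h2 (norm_nonneg _) (by positivity)
  nlinarith

end Literature.NumberTheory.Sieve.CFZ
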